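import Mathlib

/-!
# Skew-cut certificate, ASSEMBLY bookkeeping at the index level: levels, weights and cube
exhaustion of a lattice-labelled mode basis (instab3 g3, cell `ns-blowup`, 2026-08-26)

HONEST FRAMING (human ruling D-0035): nothing here is a claim about Navier–Stokes blow-up.
WHAT THIS IS NOT: not NS evidence; no certificate, no word of the census moves. This file discharges
the part of the ASSEMBLY obligations of `HOME/instab4/KERNEL-CHAIN.md` §2 that does not depend on the
operator at all, only on the fact that the modes of the (class-II Fourier–Craya, or any other) basis
are LABELLED BY LATTICE VECTORS `k : ι → ℤ³` with finitely many modes per cube `‖k‖_∞ ≤ n`: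

* (A1) LEVELS — `levels_nonpos`, `tendsto_levels_atBot`: the free levels `ℓ_i = −ν|k_i|²` are `≤ 0`
  and tend to `−∞` along the cofinite filter; these are literally the hypotheses `hℓ`, `hℓt` of
  `SkewCutGalerkinWeights.exists_resolventSymbol` (instab4 g4), which then supplies the resolvent
  symbol `d_i = (x₀ − ℓ_i)⁻¹` and the weights `w_i = √(1 + |ℓ_i|)` of the master theorem
  `SkewCutGalerkinFromSections.exists_smooth_eigenvector_Ioo_of_sections`.
* (A2, the constant `L`) BAND-COMPARABLE WEIGHTS — `one_add_levels_le_of_neighbour`,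
  `weight_le_of_neighbour`: if two modes are band neighbours, `|k_i − k_j|² ≤ 1` (the advection by
  the ABC flow couples `k` only to `k ± e_m`), then `1 + ν|k_i|² ≤ 2(1+ν)·(1 + ν|k_j|²)`, hence
  `w_i ≤ √(2(1+ν))·w_j`.
* (A3, the family `F`) CUBE EXHAUSTION — `cube_exhaustion`: the cubes `F n = {i : ‖k_i‖_∞ ≤ n}` are
  finite sets, monotone in `n`, and exhaust `ι` (the `F`, `hF`, `hFex` of the master theorem; the
  certificate's sections are indexed by exactly these cubes, SKEWCUT-CERT (F3)).
* `finite_cube_fibre_of_injective` — the finiteness hypothesis holds for every index type that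
  embeds into `ℤ³ × Fin c` (Craya index `c = 2`; the class-II orbit-pair columns are a subtype).

What stays for an ASSEMBLY seat: the matrix `t` itself ((A2) proper: entries, band sets, growth,
Schur sums), the identification of the certifier's sections ((A3) proper, (A4)), class restriction
(A5) and Fourier synthesis (A6). Mathlib only; no definitions (cubes are written as
`Set.Finite.toFinset` of the fibre sets).
-/

namespace Summit.NavierStokesRegularity.FluidComputer.SkewCutGalerkinLattice

open Filter Finset

variable {ι : Type*}

/-! ## (A1) Levels -/

/-- The free levels `ℓ_i = −ν|k_i|²` are nonpositive (`ν ≥ 0`). -/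
theorem levels_nonpos {ν : ℝ} (hν : 0 ≤ ν) (k : ι → Fin 3 → ℤ) (i : ι) :
    -(ν * ∑ m, ((k i m : ℝ)) ^ 2) ≤ 0 := by
  have : 0 ≤ ∑ m, ((k i m : ℝ)) ^ 2 := Finset.sum_nonneg fun m _ => sq_nonneg _
  nlinarith

/-- **(A1) `ℓ → −∞` along the cofinite filter.** If every cube `{i : |k_i m| ≤ n ∀ m}` contains
finitely many modes, then `ℓ_i = −ν|k_i|² → −∞` cofinitely (`ν > 0`): outside the cube of side
`⌈√(|B|/ν)⌉` one has `ℓ_i ≤ B`. This is the hypothesis `hℓt` of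
`SkewCutGalerkinWeights.exists_resolventSymbol`. -/
theorem tendsto_levels_atBot {ν : ℝ} (hν : 0 < ν) (k : ι → Fin 3 → ℤ)
    (hfin : ∀ n : ℕ, Set.Finite {i : ι | ∀ m, |k i m| ≤ (n : ℤ)}) :
    Tendsto (fun i => -(ν * ∑ m, ((k i m : ℝ)) ^ 2)) cofinite atBot := by
  rw [tendsto_atBot]
  intro B
  rw [eventually_cofinite]
  set n : ℕ := ⌈Real.sqrt (|B| / ν)⌉₊ with hn
  refine (hfin n).subset ?_
  intro i hi
  simp only [Set.mem_setOf_eq, not_le] at hi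
  -- hi : B < -(ν * S); hence S < |B|/ν ≤ n²
  have hS : ∑ m, ((k i m : ℝ)) ^ 2 < (n : ℝ) ^ 2 := by
    have h1 : ν * ∑ m, ((k i m : ℝ)) ^ 2 < |B| := by
      have := neg_abs_le B
      linarith
    have h2 : ∑ m, ((k i m : ℝ)) ^ 2 < |B| / ν := by
      rw [lt_div_iff₀ hν]; linarith
    have h0 : 0 ≤ |B| / ν := div_nonneg (abs_nonneg B) hν.le
    have hs : Real.sqrt (|B| / ν) ≤ n := by rw [hn]; exact Nat.le_ceil _
    have h3 : |B| / ν ≤ (n : ℝ) ^ 2 := by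
      calc |B| / ν = Real.sqrt (|B| / ν) ^ 2 := (Real.sq_sqrt h0).symm
        _ ≤ (n : ℝ) ^ 2 := pow_le_pow_left₀ (Real.sqrt_nonneg _) hs 2
    linarith
  intro m
  have hkm : ((k i m : ℝ)) ^ 2 ≤ ∑ m', ((k i m' : ℝ)) ^ 2 :=
    Finset.single_le_sum (f := fun m' => ((k i m' : ℝ)) ^ 2) (fun _ _ => sq_nonneg _)
      (Finset.mem_univ m)
  have habs : |((k i m : ℤ) : ℝ)| < (n : ℝ) := by
    have h := sq_lt_sq.mp (lt_of_le_of_lt hkm hS)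
    simpa [Nat.abs_cast] using h
  have hcast : (((|k i m|) : ℤ) : ℝ) < ((n : ℤ) : ℝ) := by
    rw [Int.cast_abs, Int.cast_natCast]; exact habs
  exact (Int.cast_lt.mp hcast).le

/-- (A1) packaged as the two hypotheses `hℓ`, `hℓt` of
`SkewCutGalerkinWeights.exists_resolventSymbol` for `ℓ_i := −ν|k_i|²`. -/
theorem levels_hypotheses {ν : ℝ} (hν : 0 < ν) (k : ι → Fin 3 → ℤ)
    (hfin : ∀ n : ℕ, Set.Finite {i : ι | ∀ m, |k i m| ≤ (n : ℤ)}) :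
    (∀ i, (fun i => -(ν * ∑ m, ((k i m : ℝ)) ^ 2)) i ≤ 0) ∧
      Tendsto (fun i => -(ν * ∑ m, ((k i m : ℝ)) ^ 2)) cofinite atBot :=
  ⟨fun i => levels_nonpos hν.le k i, tendsto_levels_atBot hν k hfin⟩

/-! ## (A2, constant `L`) Band-comparable weights -/

/-- **Neighbouring modes have comparable levels.** If `|k_i − k_j|² ≤ 1` (band neighbours: the ABC
advection couples `k` only to `k ± e_m`), then `1 + ν|k_i|² ≤ 2(1+ν)·(1 + ν|k_j|²)` (`ν ≥ 0`). -/
theorem one_add_levels_le_of_neighbour {ν : ℝ} (hν : 0 ≤ ν) (ki kj : Fin 3 → ℤ)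
    (hq : ∑ m, (((ki m : ℤ) : ℝ) - ((kj m : ℤ) : ℝ)) ^ 2 ≤ 1) :
    1 + ν * ∑ m, ((ki m : ℝ)) ^ 2 ≤ 2 * (1 + ν) * (1 + ν * ∑ m, ((kj m : ℝ)) ^ 2) := by
  have hterm : ∀ m, ((ki m : ℝ)) ^ 2 ≤
      2 * ((kj m : ℝ)) ^ 2 + 2 * (((ki m : ℤ) : ℝ) - ((kj m : ℤ) : ℝ)) ^ 2 := by
    intro m
    nlinarith [sq_nonneg (((ki m : ℤ) : ℝ) - 2 * ((kj m : ℤ) : ℝ))]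
  have hsum : ∑ m, ((ki m : ℝ)) ^ 2 ≤
      2 * ∑ m, ((kj m : ℝ)) ^ 2 + 2 * ∑ m, (((ki m : ℤ) : ℝ) - ((kj m : ℤ) : ℝ)) ^ 2 := by
    rw [Finset.mul_sum, Finset.mul_sum, ← Finset.sum_add_distrib]
    exact Finset.sum_le_sum fun m _ => hterm m
  have hj : 0 ≤ ∑ m, ((kj m : ℝ)) ^ 2 := Finset.sum_nonneg fun m _ => sq_nonneg _
  have hνj : 0 ≤ ν * ∑ m, ((kj m : ℝ)) ^ 2 := mul_nonneg hν hj
  nlinarith [mul_le_mul_of_nonneg_left hsum hν, mul_nonneg hν hνj, mul_le_mul_of_nonneg_left hq hν]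

/-- **Band-comparable weights** (the constant `L = √(2(1+ν))` of obligation (A2)): for band
neighbours, `w_i ≤ √(2(1+ν))·w_j` with `w = √(1 + |ℓ|)`, `ℓ = −ν|k|²` — the hypothesis `hL` of
`SkewCutGalerkinFromSections.exists_smooth_eigenvector_Ioo_of_sections`. -/
theorem weight_le_of_neighbour {ν : ℝ} (hν : 0 ≤ ν) (ki kj : Fin 3 → ℤ)
    (hq : ∑ m, (((ki m : ℤ) : ℝ) - ((kj m : ℤ) : ℝ)) ^ 2 ≤ 1) :
    Real.sqrt (1 + |-(ν * ∑ m, ((ki m : ℝ)) ^ 2)|) ≤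
      Real.sqrt (2 * (1 + ν)) * Real.sqrt (1 + |-(ν * ∑ m, ((kj m : ℝ)) ^ 2)|) := by
  have hi : 0 ≤ ν * ∑ m, ((ki m : ℝ)) ^ 2 :=
    mul_nonneg hν (Finset.sum_nonneg fun m _ => sq_nonneg _)
  have hj : 0 ≤ ν * ∑ m, ((kj m : ℝ)) ^ 2 :=
    mul_nonneg hν (Finset.sum_nonneg fun m _ => sq_nonneg _)
  rw [abs_neg, abs_neg, abs_of_nonneg hi, abs_of_nonneg hj,
    ← Real.sqrt_mul (by positivity : (0 : ℝ) ≤ 2 * (1 + ν))]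
  exact Real.sqrt_le_sqrt (one_add_levels_le_of_neighbour hν ki kj hq)

/-! ## (A3, family `F`) Cube exhaustion -/

/-- **Cube exhaustion.** With finitely many modes per cube, the cubes
`F n := {i : |k_i m| ≤ n ∀ m}` (as `Finset`s) are monotone in `n`, exhaust `ι`, and have the stated
membership — the `F`, `hF`, `hFex` of the master theorem; the certificate's Galerkin sections are
indexed by exactly these cubes (SKEWCUT-CERT (F3), cube truncations `|k|_∞ ≤ K′`). -/
theorem cube_exhaustion (k : ι → Fin 3 → ℤ)
    (hfin : ∀ n : ℕ, Set.Finite {i : ι | ∀ m, |k i m| ≤ (n : ℤ)}) :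
    Monotone (fun n => (hfin n).toFinset) ∧ (∀ i, ∃ n, i ∈ (hfin n).toFinset) ∧
      ∀ n i, i ∈ (hfin n).toFinset ↔ ∀ m, |k i m| ≤ (n : ℤ) := by
  have hmem : ∀ n i, i ∈ (hfin n).toFinset ↔ ∀ m, |k i m| ≤ (n : ℤ) := fun n i => by
    rw [Set.Finite.mem_toFinset]; rfl
  refine ⟨?_, ?_, hmem⟩
  · intro a b hab i hi
    rw [hmem] at hi ⊢
    exact fun m => (hi m).trans (by exact_mod_cast hab)
  · intro i
    refine ⟨∑ m, (k i m).natAbs, ?_⟩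
    rw [hmem]
    intro m
    rw [Int.abs_eq_natAbs]
    have : (k i m).natAbs ≤ ∑ m', (k i m').natAbs :=
      Finset.single_le_sum (f := fun m' => (k i m').natAbs) (fun _ _ => Nat.zero_le _)
        (Finset.mem_univ m)
    exact_mod_cast this

/-! ## The finiteness hypothesis for lattice-embedded index types -/

/-- **Finitely many modes per cube** for every index type that embeds into `ℤ³ × Fin c` (the Craya
index `(k, b)`, `b ∈ Fin 2`; the class-II orbit-pair columns of the certifiers are a subtype of it):
the cube fibre `{i : |k_i m| ≤ n ∀ m}` is finite. -/
theorem finite_cube_fibre_of_injective {c : ℕ} (lab : ι → (Fin 3 → ℤ) × Fin c)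
    (hlab : Function.Injective lab) (n : ℕ) :
    Set.Finite {i : ι | ∀ m, |(lab i).1 m| ≤ (n : ℤ)} := by
  have hS : (Set.univ.pi fun (_ : Fin 3) => Set.Icc (-(n : ℤ)) n).Finite :=
    Set.Finite.pi fun _ => Set.finite_Icc _ _
  have hP : ((Set.univ.pi fun (_ : Fin 3) => Set.Icc (-(n : ℤ)) n) ×ˢ
      (Set.univ : Set (Fin c))).Finite := hS.prod Set.finite_univ
  refine (hP.preimage hlab.injOn).subset ?_
  intro i hi
  simp only [Set.mem_setOf_eq] at hi
  simp only [Set.mem_preimage, Set.mem_prod, Set.mem_pi, Set.mem_univ, Set.mem_Icc, true_implies,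
    and_true]
  exact fun m => abs_le.mp (hi m)

/-! ## (A2, constant `W`) Band neighbour sets and their cardinality (appended 2026-08-26, instab3 g3)

The `nbr`, `hsymm` and `hW` data of `SkewCutGalerkinFromSections.exists_smooth_eigenvector_Ioo_of_sections`
for a lattice-embedded index type: neighbours = modes whose lattice labels are at `ℓ¹`-distance `1`
(the six `k ± e_m`), at most `6c` of them when the label `(k, b)`, `b ∈ Fin c`, is injective. -/

/-- Integer vectors at `ℓ¹`-distance `1` differ by a unit vector: if `∑ m |d m| = 1` and `d m₀ ≠ 0`
then `d m = 0` for `m ≠ m₀` (and `|d m₀| = 1`). -/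
theorem eq_zero_of_sum_abs_eq_one {d : Fin 3 → ℤ} (hd : ∑ m, |d m| = 1) {m₀ : Fin 3}
    (hm₀ : d m₀ ≠ 0) {m : Fin 3} (hm : m ≠ m₀) : d m = 0 := by
  have h1 : 1 ≤ |d m₀| := Int.one_le_abs hm₀
  have hsplit : |d m₀| + ∑ m' ∈ univ.erase m₀, |d m'| = 1 := by
    rw [Finset.add_sum_erase univ (fun m => |d m|) (Finset.mem_univ m₀)]; exact hd
  have hrest : ∑ m' ∈ univ.erase m₀, |d m'| = 0 := by
    have h0 : 0 ≤ ∑ m' ∈ univ.erase m₀, |d m'| := Finset.sum_nonneg fun _ _ => abs_nonneg _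
    omega
  have hmem : m ∈ univ.erase m₀ := Finset.mem_erase.mpr ⟨hm, Finset.mem_univ m⟩
  have := (Finset.sum_eq_zero_iff_of_nonneg fun _ _ => abs_nonneg _).mp hrest m hmem
  exact abs_eq_zero.mp this

/-- **Band neighbour sets.** For an index type embedded in `ℤ³ × Fin c` by `lab = (k, b)`, the
neighbour sets `nbr i = {j : ∑ m |k_j m − k_i m| = 1}` (the ABC advection couples `k` only to
`k ± e_m`) exist as `Finset`s, are symmetric, and have at most `6c` elements — the `nbr`, `hsymm`,
`W = 6c` of `SkewCutGalerkinFromSections.exists_smooth_eigenvector_Ioo_of_sections`. -/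
theorem exists_neighbour_finsets {c : ℕ} (lab : ι → (Fin 3 → ℤ) × Fin c)
    (hlab : Function.Injective lab) :
    ∃ nbr : ι → Finset ι,
      (∀ i j, j ∈ nbr i ↔ ∑ m, |(lab j).1 m - (lab i).1 m| = 1) ∧
      (∀ i j, j ∈ nbr i ↔ i ∈ nbr j) ∧ ∀ i, (nbr i).card ≤ 6 * c := by
  classical
  -- finiteness of each neighbour set: inside the cube fibre of side n_i + 1
  have hfin : ∀ i, Set.Finite {j : ι | ∑ m, |(lab j).1 m - (lab i).1 m| = 1} := by
    intro i
    set n : ℕ := ∑ m, ((lab i).1 m).natAbs + 1 with hn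
    refine (finite_cube_fibre_of_injective lab hlab n).subset ?_
    intro j hj m
    simp only [Set.mem_setOf_eq] at hj ⊢
    have hdm : |(lab j).1 m - (lab i).1 m| ≤ 1 := by
      rw [← hj]
      exact Finset.single_le_sum (f := fun m' => |(lab j).1 m' - (lab i).1 m'|)
        (fun _ _ => abs_nonneg _) (Finset.mem_univ m)
    have hki : |(lab i).1 m| ≤ ∑ m', |(lab i).1 m'| :=
      Finset.single_le_sum (f := fun m' => |(lab i).1 m'|) (fun _ _ => abs_nonneg _)
        (Finset.mem_univ m)
    have htri : |(lab j).1 m| ≤ |(lab j).1 m - (lab i).1 m| + |(lab i).1 m| := by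
      have := abs_add_le ((lab j).1 m - (lab i).1 m) ((lab i).1 m)
      simpa using this
    have hcast : ((n : ℕ) : ℤ) = ∑ m', |(lab i).1 m'| + 1 := by
      simp [hn]
    rw [hcast]
    linarith
  refine ⟨fun i => (hfin i).toFinset, fun i j => by rw [Set.Finite.mem_toFinset]; rfl, ?_, ?_⟩
  · intro i j
    rw [Set.Finite.mem_toFinset, Set.Finite.mem_toFinset]
    simp only [Set.mem_setOf_eq]
    have : ∀ m, |(lab j).1 m - (lab i).1 m| = |(lab i).1 m - (lab j).1 m| := fun m => abs_sub_comm _ _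
    simp only [this]
  · intro i
    -- inject nbr i into (Fin 3 × Bool) × Fin c: j ↦ ((coordinate where k_j ≠ k_i, sign), b_j)
    have hex : ∀ j ∈ (hfin i).toFinset, ∃ m, (lab j).1 m - (lab i).1 m ≠ 0 := by
      intro j hj
      rw [Set.Finite.mem_toFinset] at hj
      simp only [Set.mem_setOf_eq] at hj
      by_contra h
      push Not at h
      have : ∑ m, |(lab j).1 m - (lab i).1 m| = 0 := Finset.sum_eq_zero fun m _ => by rw [h m, abs_zero]
      omega
    let f : ι → (Fin 3 × Bool) × Fin c := fun j =>
      if h : ∃ m, (lab j).1 m - (lab i).1 m ≠ 0 then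
        ((Classical.choose h, decide (0 < (lab j).1 (Classical.choose h) - (lab i).1 (Classical.choose h))), (lab j).2)
      else ((0, true), (lab j).2)
    have hcard : ((univ : Finset (Fin 3 × Bool)) ×ˢ (univ : Finset (Fin c))).card = 6 * c := by
      simp
    rw [← hcard]
    refine Finset.card_le_card_of_injOn f (fun j _ => Finset.mem_product.mpr ⟨mem_univ _, mem_univ _⟩) ?_
    intro j hj j' hj' hff
    have hjs : ∑ m, |(lab j).1 m - (lab i).1 m| = 1 := by
      have := hj; rw [Finset.mem_coe, Set.Finite.mem_toFinset] at this; exact this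
    have hj's : ∑ m, |(lab j').1 m - (lab i).1 m| = 1 := by
      have := hj'; rw [Finset.mem_coe, Set.Finite.mem_toFinset] at this; exact this
    obtain hxj := hex j hj
    obtain hxj' := hex j' hj'
    simp only [f, dif_pos hxj, dif_pos hxj', Prod.mk.injEq] at hff
    obtain ⟨⟨hm, hsgn⟩, hb⟩ := hff
    have hm₀j : (lab j).1 (Classical.choose hxj) - (lab i).1 (Classical.choose hxj) ≠ 0 :=
      Classical.choose_spec hxj
    have hm₀j' : (lab j').1 (Classical.choose hxj) - (lab i).1 (Classical.choose hxj) ≠ 0 := by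
      rw [hm]; exact Classical.choose_spec hxj'
    -- the two difference vectors agree: both are ± e_{m₀} with the same sign
    have hd : ∀ m, (lab j).1 m - (lab i).1 m = (lab j').1 m - (lab i).1 m := by
      intro m
      by_cases hmm : m = Classical.choose hxj
      · subst hmm
        -- |d| = 1 for both, same sign
        have a1 : |(lab j).1 (Classical.choose hxj) - (lab i).1 (Classical.choose hxj)| = 1 := by
          have hz := fun m (hm : m ≠ Classical.choose hxj) => eq_zero_of_sum_abs_eq_one hjs hm₀j hm
          have : ∑ m, |(lab j).1 m - (lab i).1 m| = |(lab j).1 (Classical.choose hxj) - (lab i).1 (Classical.choose hxj)| := by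
            rw [← Finset.add_sum_erase _ _ (Finset.mem_univ (Classical.choose hxj))]
            rw [Finset.sum_eq_zero fun m hm => by rw [hz m (Finset.ne_of_mem_erase hm), abs_zero]]
            ring
          rw [← this]; exact hjs
        have a2 : |(lab j').1 (Classical.choose hxj) - (lab i).1 (Classical.choose hxj)| = 1 := by
          have hz := fun m (hm : m ≠ Classical.choose hxj) => eq_zero_of_sum_abs_eq_one hj's hm₀j' hm
          have : ∑ m, |(lab j').1 m - (lab i).1 m| = |(lab j').1 (Classical.choose hxj) - (lab i).1 (Classical.choose hxj)| := by
            rw [← Finset.add_sum_erase _ _ (Finset.mem_univ (Classical.choose hxj))]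
            rw [Finset.sum_eq_zero fun m hm => by rw [hz m (Finset.ne_of_mem_erase hm), abs_zero]]
            ring
          rw [← this]; exact hj's
        rw [← hm] at hsgn
        rcases abs_eq (zero_le_one) |>.mp a1 with h1 | h1 <;> rcases abs_eq (zero_le_one) |>.mp a2 with h2 | h2
        · rw [h1, h2]
        · exfalso; rw [h1, h2] at hsgn; simp at hsgn
        · exfalso; rw [h1, h2] at hsgn; simp at hsgn
        · rw [h1, h2]
      · rw [eq_zero_of_sum_abs_eq_one hjs hm₀j hmm, eq_zero_of_sum_abs_eq_one hj's hm₀j' hmm]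
    have hk : (lab j).1 = (lab j').1 := by
      funext m; have := hd m; linarith
    exact hlab (Prod.ext hk hb)

/-! ## (A2, Schur sums) Row and column sums of a banded matrix are automatic (appended 2026-08-26, instab3 g3)

For the matrix `t_ij = a_ij · d_j` of the relative bound (`a` banded with `nbr`, `‖a_ij‖ ≤ K·w_j`
first-order growth, `d_j = (x₀ − ℓ_j)⁻¹`, `‖d_j‖·w_j ≤ M`): every entry is bounded by `K·M`, rows and
columns are supported in the (symmetric) band of width `≤ W`, hence the SCHUR SUMS of
`SkewCutGalerkinFromSections.exists_smooth_eigenvector_Ioo_of_sections` hold with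
`R₀ = C₀ = W·K·M`, and the Schur condition `R₀C₀ < 1` is the single scalar inequality `W·K·M < 1`
(for `ℓ = −ν|k|²`, `w = √(1+|ℓ|)`: `M(x₀) ≤ 1/√x₀`, so any `x₀ > (W K)²` works). -/

section Schur

variable {𝕜 : Type*} [RCLike 𝕜]

/-- Entry bound from band growth and the weight/symbol product: `‖t_ij‖ ≤ K·M`. -/
theorem norm_entry_le_of_band (t : ι → ι → 𝕜) (ℓ : ι → ℝ) (x₀ : ℝ) (d : ι → 𝕜)
    (hd : ∀ i, d i * ((x₀ : 𝕜) - (ℓ i : 𝕜)) = 1) (nbr : ι → Finset ι)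
    (ht0 : ∀ i j, j ∉ nbr i → t i j = 0) (wgt : ι → ℝ) {K M : ℝ} (hK : 0 ≤ K)
    (ha : ∀ i j, j ∈ nbr i → ‖t i j * ((x₀ : 𝕜) - (ℓ j : 𝕜))‖ ≤ K * wgt j)
    (hM : ∀ i, ‖d i‖ * wgt i ≤ M) (hM0 : 0 ≤ M) (i j : ι) : ‖t i j‖ ≤ K * M := by
  by_cases hj : j ∈ nbr i
  · have e : t i j = (t i j * ((x₀ : 𝕜) - (ℓ j : 𝕜))) * d j := by
      rw [mul_assoc, mul_comm ((x₀ : 𝕜) - (ℓ j : 𝕜)) (d j), hd j, mul_one]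
    rw [e, norm_mul]
    calc ‖t i j * ((x₀ : 𝕜) - (ℓ j : 𝕜))‖ * ‖d j‖ ≤ (K * wgt j) * ‖d j‖ :=
          mul_le_mul_of_nonneg_right (ha i j hj) (norm_nonneg _)
      _ = K * (‖d j‖ * wgt j) := by ring
      _ ≤ K * M := mul_le_mul_of_nonneg_left (hM j) hK
  · rw [ht0 i j hj, norm_zero]; exact mul_nonneg hK hM0

/-- **Row sums.** A row supported in `nbr i` (`card ≤ W`) with entries `≤ B` is absolutely summable
with `∑' j ‖t i j‖ ≤ W·B`. -/
theorem row_schur_of_band (t : ι → ι → 𝕜) (nbr : ι → Finset ι) {W : ℕ}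
    (hW : ∀ i, (nbr i).card ≤ W) (ht0 : ∀ i j, j ∉ nbr i → t i j = 0) {B : ℝ} (hB : 0 ≤ B)
    (hb : ∀ i j, ‖t i j‖ ≤ B) (i : ι) :
    Summable (fun j => ‖t i j‖) ∧ ∑' j, ‖t i j‖ ≤ W * B := by
  have hsupp : ∀ j ∉ nbr i, ‖t i j‖ = 0 := fun j hj => by rw [ht0 i j hj, norm_zero]
  have hsum : Summable (fun j => ‖t i j‖) := summable_of_ne_finset_zero hsupp
  refine ⟨hsum, ?_⟩
  rw [tsum_eq_sum hsupp]
  calc ∑ j ∈ nbr i, ‖t i j‖ ≤ ∑ j ∈ nbr i, B := Finset.sum_le_sum fun j _ => hb i j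
    _ = (nbr i).card * B := by rw [Finset.sum_const, nsmul_eq_mul]
    _ ≤ W * B := mul_le_mul_of_nonneg_right (by exact_mod_cast hW i) hB

/-- **Column sums**, using the symmetry of the band (`j ∈ nbr i ↔ i ∈ nbr j`). -/
theorem col_schur_of_band (t : ι → ι → 𝕜) (nbr : ι → Finset ι)
    (hsymm : ∀ i j, j ∈ nbr i ↔ i ∈ nbr j) {W : ℕ} (hW : ∀ i, (nbr i).card ≤ W)
    (ht0 : ∀ i j, j ∉ nbr i → t i j = 0) {B : ℝ} (hB : 0 ≤ B) (hb : ∀ i j, ‖t i j‖ ≤ B) (j : ι) :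
    Summable (fun i => ‖t i j‖) ∧ ∑' i, ‖t i j‖ ≤ W * B := by
  have hsupp : ∀ i ∉ nbr j, ‖t i j‖ = 0 := fun i hi => by
    have : j ∉ nbr i := fun h => hi ((hsymm i j).mp h)
    rw [ht0 i j this, norm_zero]
  have hsum : Summable (fun i => ‖t i j‖) := summable_of_ne_finset_zero hsupp
  refine ⟨hsum, ?_⟩
  rw [tsum_eq_sum hsupp]
  calc ∑ i ∈ nbr j, ‖t i j‖ ≤ ∑ i ∈ nbr j, B := Finset.sum_le_sum fun i _ => hb i j
    _ = (nbr j).card * B := by rw [Finset.sum_const, nsmul_eq_mul]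
    _ ≤ W * B := mul_le_mul_of_nonneg_right (by exact_mod_cast hW j) hB

/-- **(A2) Schur data of the relative bound from band + growth + weights.** With `B := K·M`: the four
Schur hypotheses `hrow`, `hR`, `hcol`, `hC₀` of the master theorem hold with `R₀ = C₀ = W·K·M`, and
`R₀·C₀ < 1` as soon as `W·K·M < 1`. -/
theorem schur_data_of_band (t : ι → ι → 𝕜) (ℓ : ι → ℝ) (x₀ : ℝ) (d : ι → 𝕜)
    (hd : ∀ i, d i * ((x₀ : 𝕜) - (ℓ i : 𝕜)) = 1) (nbr : ι → Finset ι)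
    (hsymm : ∀ i j, j ∈ nbr i ↔ i ∈ nbr j) {W : ℕ} (hW : ∀ i, (nbr i).card ≤ W)
    (ht0 : ∀ i j, j ∉ nbr i → t i j = 0) (wgt : ι → ℝ) {K M : ℝ} (hK : 0 ≤ K) (hM0 : 0 ≤ M)
    (ha : ∀ i j, j ∈ nbr i → ‖t i j * ((x₀ : 𝕜) - (ℓ j : 𝕜))‖ ≤ K * wgt j)
    (hM : ∀ i, ‖d i‖ * wgt i ≤ M) (hq : (W : ℝ) * K * M < 1) :
    (∀ i, Summable fun j => ‖t i j‖) ∧ (∀ i, ∑' j, ‖t i j‖ ≤ W * (K * M)) ∧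
      (∀ j, Summable fun i => ‖t i j‖) ∧ (∀ j, ∑' i, ‖t i j‖ ≤ W * (K * M)) ∧
      0 ≤ (W : ℝ) * (K * M) ∧ (W : ℝ) * (K * M) * ((W : ℝ) * (K * M)) < 1 := by
  have hb : ∀ i j, ‖t i j‖ ≤ K * M :=
    norm_entry_le_of_band t ℓ x₀ d hd nbr ht0 wgt hK ha hM hM0
  have hKM : 0 ≤ K * M := mul_nonneg hK hM0
  have hrow := fun i => row_schur_of_band t nbr hW ht0 hKM hb i
  have hcol := fun j => col_schur_of_band t nbr hsymm hW ht0 hKM hb j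
  have hR0 : 0 ≤ (W : ℝ) * (K * M) := mul_nonneg (Nat.cast_nonneg W) hKM
  refine ⟨fun i => (hrow i).1, fun i => (hrow i).2, fun j => (hcol j).1, fun j => (hcol j).2, hR0, ?_⟩
  have h1 : (W : ℝ) * (K * M) < 1 := by rw [← mul_assoc]; exact hq
  nlinarith

end Schur

/-- For the free levels `ℓ = −ν|k|²`, the weight/symbol product is `≤ 1/√x₀` (`x₀ ≥ 1`):
`√(1 + |ℓ_i|)/(x₀ − ℓ_i) ≤ 1/√x₀`, so the Schur condition of `schur_data_of_band` holds for every
`x₀ > (W K)²`. Stated for any `ℓ_i ≤ 0`. -/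
theorem weight_mul_symbol_le {ℓi x₀ : ℝ} (hℓ : ℓi ≤ 0) (hx₀ : 1 ≤ x₀) :
    (x₀ - ℓi)⁻¹ * Real.sqrt (1 + |ℓi|) ≤ 1 / Real.sqrt x₀ := by
  have habs : |ℓi| = -ℓi := abs_of_nonpos hℓ
  have hpos : 0 < x₀ - ℓi := by linarith
  have hx : 0 < x₀ := by linarith
  rw [habs]
  -- √(1 - ℓ) ≤ √(x₀ - ℓ) and (x₀ - ℓ)⁻¹ √(x₀ - ℓ) = 1/√(x₀ - ℓ) ≤ 1/√x₀
  have h1 : Real.sqrt (1 + -ℓi) ≤ Real.sqrt (x₀ - ℓi) := Real.sqrt_le_sqrt (by linarith)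
  have h2 : (x₀ - ℓi)⁻¹ * Real.sqrt (x₀ - ℓi) = 1 / Real.sqrt (x₀ - ℓi) := by
    have hs : Real.sqrt (x₀ - ℓi) ≠ 0 := (Real.sqrt_pos.mpr hpos).ne'
    field_simp
    rw [Real.sq_sqrt hpos.le]
  calc (x₀ - ℓi)⁻¹ * Real.sqrt (1 + -ℓi) ≤ (x₀ - ℓi)⁻¹ * Real.sqrt (x₀ - ℓi) :=
        mul_le_mul_of_nonneg_left h1 (inv_nonneg.mpr hpos.le)
    _ = 1 / Real.sqrt (x₀ - ℓi) := h2
    _ ≤ 1 / Real.sqrt x₀ := by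
        apply one_div_le_one_div_of_le (Real.sqrt_pos.mpr hx)
        exact Real.sqrt_le_sqrt (by linarith)

end Summit.NavierStokesRegularity.FluidComputer.SkewCutGalerkinLattice
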